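import Summits.RiemannHypothesis.RiemannHypothesis.Theses.RuelleBand
import Literature.NumberTheory.LFunctions.WeilExplicit
import Literature.NumberTheory.LFunctions.WeilCriterionConverse
import Literature.NumberTheory.LFunctions.WeilSemilocalCompactness
import Literature.NumberTheory.LFunctions.WeilWindowSuzuki
import HarnessLib.Audit

/-!
# Line `cofinite-weil-index-staircase` — skeleton for crux `RuelleBand.CofiniteCriticalLine`
(item stmt-RiemannHypothesis-2064, route route-RiemannHypothesis-RuelleBand; crux-plan, round 1)

Crux (FIXED, route decl): `CofiniteCriticalLine : {s | ζ s = 0 ∧ 0 < re s < 1 ∧ re s ≠ 1/2}.Finite`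
("all but finitely many non-trivial zeros lie on the critical line").

Idea (crux idea `Cruxes/CofiniteCriticalLine/Ideas/cofinite-weil-index-staircase.md`, triage r1 k1–k3:
pass; merged reading "one Weil-INDEX line, bet = eventual non-degeneracy"): the negative index
`n₋(a)` of Weil's quadratic form `Q(g) = W(g ⋆ g̃)` (`weilQuadratic`) restricted to test functions on
the window `[-a, a]` is finite for every window (Yoshida 1992; Connes–Consani–Moscovici 2025 Thm 3.6,
PROVED in tree as `ConnesConsaniMoscovici2025_thm_3_6_holds`), non-decreasing in `a`, and can step up
between two windows only across a CONJUGATE WINDOW `a*` at which the closed window form has a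
non-zero null vector (a zero min–max level; Morse–Kneser shape).  If no conjugate window occurs
beyond some `a₀` (the BET, `stub_eventuallyNondegenerate`, typed on the FORM DOMAIN as the triage
asked), the staircase is bounded; a uniformly bounded index makes every translation kernel
`x ↦ Q(f_x, f)` a function with `≤ N` negative squares, hence DEFINITIZABLE by a polynomial
differential operator of degree `≤ N` (Pontryagin 1944 / Kreĭn–Langer 1977 / Sasvári 1994,
`stub_definitize`); and Weil positivity on the translation orbit of ONE test function `p(-D) f`
already forces `m(ρ) · p(ρ-½) conj p(½-ρ̄) · f̂(ρ) conj f̂(1-ρ̄) = 0` at every off-line zero (the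
Laplace-transform / identity-theorem proof of `WeilConverse.order_mul_pairCoeff_eq_zero` runs inside
the orbit), so all off-line zeros seen by `f` sit among the `≤ 2D` points `½ + roots p`,
`½ - conj roots p`; a generic narrow bump sees any prescribed finite set of zeros — this is the
COFINITE WEIL CRITERION of the card (`stub_cofiniteWeilCriterion`, concluding the finiteness of the
off-line zero set verbatim), and `CofiniteCriticalLine_of` concludes the crux BY NAME.

Dictionary (all VERBATIM expansions, no local `def`, so that every stub lands as a pure theorem over
existing declarations; `Q = weilQuadratic`, `W = weilFunctional`, tests = `IsWeilTest`):
* `WindowIndexLE a N`   ↦ `∀ g : Fin (N+1) → ℝ → ℂ, (∀ i, IsWeilTest (g i)) → (∀ i, tsupport (g i) ⊆ Icc (-a) a) →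
                           ∃ c ≠ 0, 0 ≤ Re Q(∑ i, c i * g i)`  (= `SketchIdeator2.WeilIndexOnLE`; `N = 0` is
                           `WeilPositivityOn a`; antitone in `a` by restriction — proved inline below);
* `HasWeilNullVector a` ↦ `∃ u g, u ∈ L², ¬ u =ᵐ 0, gₙ window tests, ∫‖gₙ - u‖² → 0,
                           Re Q(gₙ - gₘ) → 0 (form-Cauchy), ∀ window tests h, W(gₙ ⋆ h̃) → 0`
                           (a non-zero vector of the FORM DOMAIN of the closed window form with
                           `Q̄(u, h) = 0` on the form core: `0 ∈ σ_p(A_a)` for the Friedrichs/CCM operator;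
                           junk-free: for `a < 0` the window is empty and the predicate is false);
* `level a k`           ↦ `sInf {x | ∃ g : Fin (k+1) → tests on the window, LinearIndependent ℂ g ∧
                           x = sSup {Re Q(∑ cᵢgᵢ) : ∫‖∑ cᵢgᵢ‖² = 1}}`  (Courant–Fischer level `μ_k(A_a)`
                           over the core; `level a 0 = weilGroundEnergy a` for `a > 0`);
* `OrbitPositive D`     ↦ `∀ f test, ∃ p : Polynomial ℂ, p ≠ 0, natDegree p ≤ D, ∀ n x c,
                           0 ≤ Re Q(t ↦ ∑ k, c k * (p(-D) f)(t - x k))`,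
                           `p(-D) f := ∑ j ≤ natDegree p, coeff p j * (-1)^j * iteratedDeriv j f`,
                           so that `(p(-D) f)^(s) = p(s - ½) f̂(s)` (`weilMellin_deriv`).

Registered stubs (7 after the lead's reshape of 2026-08-16; sorries ONLY here) and composition:
`stub_eventuallyNondegenerate` (BET) → `stub_branchesContinuous` → (`stub_zeroLevelWindow` →
`stub_zeroLevelNullVector`, glued by the proved `conjugateWindow_of_stubs`) →
`stub_windowIndexFinite` → `stub_definitize` → `stub_cofiniteWeilCriterion`; the closed theorem
`CofiniteCriticalLine_of : RuelleBand.CofiniteCriticalLine` uses them BY NAME (kernel-checked: `a₁ := max a₀ 1`, `N := n₋`-bound at `a₁`; windows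
`a ≤ a₁` by restriction, windows `a > a₁` by the conjugate-window lemma against the bet).

Disproof.lean (cdisprove cycle 1, v4) honoured: `cofiniteCriticalLine_false_without_neHalf` (Hardy) —
the line kills only OFF-line coefficients (`Re (ρ - ½) ≠ 0` in the fibre lemma
`BoundedPowerSum.sum_fiber_eq_zero_of_exp_real`, used at `stub_cofiniteWeilCriterion`); on-line zeros
contribute `m(ρ)|ĝ(ρ)|² ≥ 0` and are never counted; `…_false_without_rePos/zeta`: the zero side runs
over `riemannZetaNontrivialZeros` only.  Landed Negative lemmas (`Theorems/CofiniteCriticalLine/Negative/`,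
read; their modules were unbuilt on the farm at check time, so they are not imported) checked against:
`Negative.not_abstract_asymptotic_imp_cofinite` (no stub derives rung #5 from rung #4's shape; the
arithmetic enters through the explicit formula with its prime term and through the bet),
`Negative.not_cofinite_shape_davenportHeilbronn` (for Davenport–Heilbronn the window index is still
finite but the staircase is unbounded: the bet is where the Euler product is load-bearing).
No `_false_without_<H>` theorem about a hypothesis H of a transfer exists (the crux has no hypotheses);
RH ⇒ every stub's statement (bet included: under RH `level a 0 = ε(a) > 0` for all `a > 0`).
-/

set_option linter.dupNamespace false

noncomputable section

open Complex MeasureTheory Filter Set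
open scoped BigOperators Topology ComplexConjugate

namespace Summit.RiemannHypothesis.RiemannHypothesis.Cruxes.CofiniteCriticalLine.CofiniteWeilIndexStaircase

open Literature.NumberTheory.LFunctions

/-! ### The registered stubs (signatures over existing declarations only) -/

/-- **Stub 1 — THE BET `C⁺` (eventual non-degeneracy, "no late conjugate window"; RH-implied,
crux-strength).**  There is `a₀` such that for every window `a ≥ a₀` the closed Weil form on `[-a, a]`
has NO non-zero null vector in its form domain: no `u ∈ L²`, `u ≠ 0`, which is an `L²`- and
form-Cauchy limit of window test functions `gₙ` with `W(gₙ ⋆ h̃) → 0` for every window test `h`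
(i.e. `0 ∉ σ_p(A_a)`, `A_a` the lower-bounded self-adjoint operator of CCM25 (3.23) / the Friedrichs
extension of Suzuki 2026 Thm 1.1; equivalently no `L²` null vector of Bombieri's truncated operator
`L_a`, Bombieri 2000 (4.2), alternative (iii) of Thms 10–11 with eigenvalue EXACTLY `0`).
Under RH it holds for every `a > 0` (`Q̄(u) = Σ m(ρ)|û(ρ)|² > 0`, `û` entire of exponential type).
Research content: unique continuation for ONE explicit delay–integral operator per window
(finitely many prime delays `log n ≤ 2a`, log-kinetic archimedean part, rank-2 polar part);
`a₀` may be ineffective. -/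
theorem stub_eventuallyNondegenerate :
    ∃ a₀ : ℝ, ∀ a : ℝ, a₀ ≤ a →
      ¬ ∃ (u : ℝ → ℂ) (g : ℕ → ℝ → ℂ), MemLp u 2 volume ∧ ¬ (u =ᵐ[volume] 0) ∧
          (∀ n, IsWeilTest (g n) ∧ tsupport (g n) ⊆ Set.Icc (-a) a) ∧
          Tendsto (fun n => ∫ t, ‖g n t - u t‖ ^ 2) atTop (𝓝 0) ∧
          Tendsto (fun q : ℕ × ℕ => (weilQuadratic (g q.1 - g q.2)).re) atTop (𝓝 0) ∧
          ∀ h : ℝ → ℂ, IsWeilTest h → tsupport h ⊆ Set.Icc (-a) a →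
            Tendsto (fun n => weilFunctional (weilConv (g n) (weilReflect h))) atTop (𝓝 0) := by
  sorry

/-- **Stub 2 — continuity of every eigenvalue branch** (triage r1-3 sharpening (2): file
`WindowBranchesContinuous` as its own stub).  For every `k`, the `k`-th Courant–Fischer level of the
window form (inf over linearly independent `(k+1)`-tuples of window test functions of the max of
`Re Q` on their unit `L²`-sphere) is continuous in the window `a ∈ (0, ∞)`.  `k = 0` is Suzuki 2026
Thm 1.3 (`Suzuki2026_thm_1_3_holds`, PROVED: `ContinuousOn weilGroundEnergy (Ioi 0)`; `level a 0 =
weilGroundEnergy a`); general `k` by the same dilation argument `g ↦ g(λ·)` applied to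
finite-dimensional subspaces plus monotonicity in `a`. -/
theorem stub_branchesContinuous :
    ∀ k : ℕ, ContinuousOn (fun a : ℝ =>
      sInf {x : ℝ | ∃ g : Fin (k + 1) → ℝ → ℂ,
        (∀ i, IsWeilTest (g i) ∧ tsupport (g i) ⊆ Set.Icc (-a) a) ∧ LinearIndependent ℂ g ∧
        x = sSup {y : ℝ | ∃ c : Fin (k + 1) → ℂ,
          ∫ t, ‖∑ i, c i * g i t‖ ^ 2 = (1 : ℝ) ∧
          y = (weilQuadratic (fun t => ∑ i, c i * g i t)).re}}) (Set.Ioi 0) := by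
  sorry

/-- **Stub 3a — a zero level between two windows of different index** (reshaped by the lead,
2026-08-16: the former single stub `stub_conjugateWindow` is now `stub_zeroLevelWindow` (this, M/L:
dictionary + intermediate value theorem) followed by `stub_zeroLevelNullVector` (attainment, the
analytic core), glued by the sorry-free `conjugateWindow_of_stubs` below).  Given branch continuity
(Stub 2): if the index bound `≤ N` holds on the window `a₁ > 0` but fails on `a₂ ≥ a₁`, then the
`N`-th Courant–Fischer level vanishes at some window `a* ∈ [a₁, a₂]`.  Proof content: the dictionary
`WindowIndexLE a N ↔ 0 ≤ level a N` for `a > 0` (a tuple on which `Re Q` is negative definite is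
linearly independent; `Re Q` restricted to a finite span is a continuous Hermitian form in the
coefficients — `weilQuadratic_add`, `weilFunctional_add`, `weilQuadratic_const_mul` — so its `sup` on
the compact unit `L²`-sphere of the span is attained; `csInf`/`csSup` bookkeeping with
`bddBelow_weilQuadratic_sphere_holds`), whence `0 ≤ level a₁ N` and `level a₂ N < 0`, and the
intermediate value theorem for the continuous `a ↦ level a N` on `[a₁, a₂] ⊆ (0, ∞)`. -/
theorem stub_zeroLevelWindow :
    (∀ k : ℕ, ContinuousOn (fun a : ℝ =>
        sInf {x : ℝ | ∃ g : Fin (k + 1) → ℝ → ℂ,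
          (∀ i, IsWeilTest (g i) ∧ tsupport (g i) ⊆ Set.Icc (-a) a) ∧ LinearIndependent ℂ g ∧
          x = sSup {y : ℝ | ∃ c : Fin (k + 1) → ℂ,
            ∫ t, ‖∑ i, c i * g i t‖ ^ 2 = (1 : ℝ) ∧
            y = (weilQuadratic (fun t => ∑ i, c i * g i t)).re}}) (Set.Ioi 0)) →
    ∀ (N : ℕ) (a₁ a₂ : ℝ), 0 < a₁ → a₁ ≤ a₂ →
      (∀ g : Fin (N + 1) → ℝ → ℂ, (∀ i, IsWeilTest (g i)) →
          (∀ i, tsupport (g i) ⊆ Set.Icc (-a₁) a₁) →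
          ∃ c : Fin (N + 1) → ℂ, c ≠ 0 ∧ 0 ≤ (weilQuadratic (fun t => ∑ i, c i * g i t)).re) →
      (¬ ∀ g : Fin (N + 1) → ℝ → ℂ, (∀ i, IsWeilTest (g i)) →
          (∀ i, tsupport (g i) ⊆ Set.Icc (-a₂) a₂) →
          ∃ c : Fin (N + 1) → ℂ, c ≠ 0 ∧ 0 ≤ (weilQuadratic (fun t => ∑ i, c i * g i t)).re) →
      ∃ a ∈ Set.Icc a₁ a₂,
        sInf {x : ℝ | ∃ g : Fin (N + 1) → ℝ → ℂ,
          (∀ i, IsWeilTest (g i) ∧ tsupport (g i) ⊆ Set.Icc (-a) a) ∧ LinearIndependent ℂ g ∧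
          x = sSup {y : ℝ | ∃ c : Fin (N + 1) → ℂ,
            ∫ t, ‖∑ i, c i * g i t‖ ^ 2 = (1 : ℝ) ∧
            y = (weilQuadratic (fun t => ∑ i, c i * g i t)).re}} = 0 := by
  sorry

/-- **Stub 3b — a zero min–max level is a null vector** (ATTAINMENT; the analytic core of the former
`stub_conjugateWindow`).  For a window `a > 0`: if the `N`-th Courant–Fischer level of the window form
over the core of window test functions is exactly `0`, then the closed window form has a non-zero null
vector in its form domain (`HasWeilNullVector a` of the dictionary: `u ∈ L²`, `u ≠ 0`, an `L²`- and
form-Cauchy limit of window tests `gₙ` with `W(gₙ ⋆ h̃) → 0` for every window test `h`; i.e.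
`0 ∈ σ_p(A_a)` for the lower-bounded self-adjoint operator of CCM25 (3.23) / Suzuki 2026 Thm 1.1).
Proof content (spectral-theorem-free): (i) CLOSABILITY of `Re Q` on window tests (the archimedean
part is `∫ |ĝ(½+it)|² (ρ(t) − ρ(0)) dt`, `ρ ≥ ρ(0)`, a closed multiplication form in Fourier space —
`weilArchIntegral_weilConv_weilReflect_re`; polar and prime parts are `L²`-bounded on the window);
(ii) level `≤ 0` and the PROVED compact embedding `ConnesConsaniMoscovici2025_thm_3_6_holds` give an
`(N+1)`-dimensional subspace `U` of the form domain with `Q̄ ≤ 0` (orthonormalised near-optimal trial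
spaces, `L²`-limits, Banach–Saks means for form-norm convergence, lower semicontinuity); (iii) level
`≥ 0` gives `WindowIndexLE a N`, which passes to the form domain by density; (iv) the radical
`R = {u ∈ U : Q̄(u) = 0}` of `Q̄|_U` (Cauchy–Schwarz for the non-positive form `Q̄|_U`) is non-zero,
and if no `r ∈ R ∖ 0` were a null vector of `Q̄`, a first-order perturbation `U⁻ ⊕ {r − t L r}` of
`U` (`L` chosen with `Q̄(rᵢ, L rⱼ) = δᵢⱼ` on a basis of `R`) would be an `(N+1)`-dimensional
`Q̄`-NEGATIVE-definite subspace, contradicting (iii); so some `u ∈ R ∖ 0` has `Q̄(u, ·) = 0` on the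
form domain, in particular on window tests, and its form-norm approximants witness the conclusion. -/
theorem stub_zeroLevelNullVector :
    ∀ (N : ℕ) (a : ℝ), 0 < a →
      sInf {x : ℝ | ∃ g : Fin (N + 1) → ℝ → ℂ,
          (∀ i, IsWeilTest (g i) ∧ tsupport (g i) ⊆ Set.Icc (-a) a) ∧ LinearIndependent ℂ g ∧
          x = sSup {y : ℝ | ∃ c : Fin (N + 1) → ℂ,
            ∫ t, ‖∑ i, c i * g i t‖ ^ 2 = (1 : ℝ) ∧
            y = (weilQuadratic (fun t => ∑ i, c i * g i t)).re}} = 0 →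
      ∃ (u : ℝ → ℂ) (g : ℕ → ℝ → ℂ), MemLp u 2 volume ∧ ¬ (u =ᵐ[volume] 0) ∧
          (∀ n, IsWeilTest (g n) ∧ tsupport (g n) ⊆ Set.Icc (-a) a) ∧
          Tendsto (fun n => ∫ t, ‖g n t - u t‖ ^ 2) atTop (𝓝 0) ∧
          Tendsto (fun q : ℕ × ℕ => (weilQuadratic (g q.1 - g q.2)).re) atTop (𝓝 0) ∧
          ∀ h : ℝ → ℂ, IsWeilTest h → tsupport h ⊆ Set.Icc (-a) a →
            Tendsto (fun n => weilFunctional (weilConv (g n) (weilReflect h))) atTop (𝓝 0) := by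
  sorry

/-- **The staircase steps only at conjugate windows** (crossing lemma; Morse–Kneser shape; the former
registered `stub_conjugateWindow`, now PROVED from Stubs 3a + 3b).  Given branch continuity (Stub 2):
if the index bound `≤ N` holds on the window `a₁ > 0` but fails on `a₂ ≥ a₁`, then some window
`a* ∈ [a₁, a₂]` carries a non-zero null vector of the closed form. [folklore] -/
theorem conjugateWindow_of_stubs :
    (∀ k : ℕ, ContinuousOn (fun a : ℝ =>
        sInf {x : ℝ | ∃ g : Fin (k + 1) → ℝ → ℂ,
          (∀ i, IsWeilTest (g i) ∧ tsupport (g i) ⊆ Set.Icc (-a) a) ∧ LinearIndependent ℂ g ∧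
          x = sSup {y : ℝ | ∃ c : Fin (k + 1) → ℂ,
            ∫ t, ‖∑ i, c i * g i t‖ ^ 2 = (1 : ℝ) ∧
            y = (weilQuadratic (fun t => ∑ i, c i * g i t)).re}}) (Set.Ioi 0)) →
    ∀ (N : ℕ) (a₁ a₂ : ℝ), 0 < a₁ → a₁ ≤ a₂ →
      (∀ g : Fin (N + 1) → ℝ → ℂ, (∀ i, IsWeilTest (g i)) →
          (∀ i, tsupport (g i) ⊆ Set.Icc (-a₁) a₁) →
          ∃ c : Fin (N + 1) → ℂ, c ≠ 0 ∧ 0 ≤ (weilQuadratic (fun t => ∑ i, c i * g i t)).re) →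
      (¬ ∀ g : Fin (N + 1) → ℝ → ℂ, (∀ i, IsWeilTest (g i)) →
          (∀ i, tsupport (g i) ⊆ Set.Icc (-a₂) a₂) →
          ∃ c : Fin (N + 1) → ℂ, c ≠ 0 ∧ 0 ≤ (weilQuadratic (fun t => ∑ i, c i * g i t)).re) →
      ∃ a ∈ Set.Icc a₁ a₂,
        ∃ (u : ℝ → ℂ) (g : ℕ → ℝ → ℂ), MemLp u 2 volume ∧ ¬ (u =ᵐ[volume] 0) ∧
          (∀ n, IsWeilTest (g n) ∧ tsupport (g n) ⊆ Set.Icc (-a) a) ∧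
          Tendsto (fun n => ∫ t, ‖g n t - u t‖ ^ 2) atTop (𝓝 0) ∧
          Tendsto (fun q : ℕ × ℕ => (weilQuadratic (g q.1 - g q.2)).re) atTop (𝓝 0) ∧
          ∀ h : ℝ → ℂ, IsWeilTest h → tsupport h ⊆ Set.Icc (-a) a →
            Tendsto (fun n => weilFunctional (weilConv (g n) (weilReflect h))) atTop (𝓝 0) := by
  intro hcont N a₁ a₂ ha₁ h₁₂ hle hnot
  obtain ⟨a, ha, hlev⟩ := stub_zeroLevelWindow hcont N a₁ a₂ ha₁ h₁₂ hle hnot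
  exact ⟨a, ha, stub_zeroLevelNullVector N a (lt_of_lt_of_le ha₁ ha.1) hlev⟩

/-- **Stub 4 — every window has finite index** (Yoshida 1992: `⟨·,·⟩_W` positive definite on a
finite-codimension subspace `K_N(a)`, reported in Suzuki 2023 arXiv:2206.03682 p. 15; Bombieri 2000
Lemma 3; here: CCM25 Thm 3.6).  Unconditional.  Proof content: if for every `N` an `(N+1)`-tuple of
window tests spans a `Re Q`-negative-definite subspace, Gram–Schmidt inside these spans yields an
infinite `L²`-orthonormal sequence of window tests with `Re Q ≤ 0`, which by the PROVED sequential
compactness `ConnesConsaniMoscovici2025_thm_3_6_holds` has an `L²`-Cauchy subsequence — absurd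
(`‖gₙ - gₘ‖₂² = 2`).  For `a < 0` the window is empty and `N = 0` works (`Q(0) = 0`). -/
theorem stub_windowIndexFinite :
    ∀ a : ℝ, ∃ N : ℕ, ∀ g : Fin (N + 1) → ℝ → ℂ, (∀ i, IsWeilTest (g i)) →
        (∀ i, tsupport (g i) ⊆ Set.Icc (-a) a) →
        ∃ c : Fin (N + 1) → ℂ, c ≠ 0 ∧ 0 ≤ (weilQuadratic (fun t => ∑ i, c i * g i t)).re := by
  sorry

/-- **Stub 5 — DEFINITIZATION (Kreĭn 1959, Dokl. 125: a continuous function with `k` negative squares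
admits a polynomial `Q` of degree `k` with `Q(-iD) Q̄(-iD) f` positive definite — quoted in
Stewart 1972, Canad. Math. Bull. 15, p. 399, READ; Pontryagin 1944; Kreĭn–Langer 1977
doi:10.1002/mana.19770770116; Sasvári 1994).**  A uniform
bound `N` on the window index makes, for every test function `f`, the translation kernel
`k_f(x) := Q(f_x, f) = W((f ⋆ f̃)_x) = Σ_ρ m(ρ) P_f(ρ) e^{(ρ-½)x}` (Gram matrices `[k_f(xᵢ - xⱼ)]` of
translates, all supported in one window) a smooth Hermitian kernel on `ℝ` with `≤ N` negative squares;
in its reproducing-kernel Pontryagin space `Π_κ(k_f)`, `κ ≤ N`, translations are unitary, the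
generator `A = -iD` is self-adjoint and has a `κ`-dimensional invariant non-positive subspace `L`
(Pontryagin); with `q` the minimal polynomial of `A|_L` (`deg q ≤ κ`), `q♯(A)` maps into `L^{[⊥]}`,
a non-negative subspace, so `[q♯(A)x, q♯(A)x] ≥ 0` — i.e. `Q ≥ 0` on the translation span of the test
function `p(-D) f`, `p` of degree `≤ N`, `(p(-D)f)^(s) = p(s-½) f̂(s)`.  Literature-grade indefinite
harmonic analysis, not in the tree (a vendored named fact `Krein1959_definitizable` — Kreĭn's
representation theorem for `𝔓_k(ℝ)` — would discharge the indefinite step; the dictionary to test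
functions is tree-side work). -/
theorem stub_definitize :
    (∃ N : ℕ, ∀ a : ℝ, ∀ g : Fin (N + 1) → ℝ → ℂ, (∀ i, IsWeilTest (g i)) →
        (∀ i, tsupport (g i) ⊆ Set.Icc (-a) a) →
        ∃ c : Fin (N + 1) → ℂ, c ≠ 0 ∧ 0 ≤ (weilQuadratic (fun t => ∑ i, c i * g i t)).re) →
    ∃ D : ℕ, ∀ f : ℝ → ℂ, IsWeilTest f → ∃ p : Polynomial ℂ, p ≠ 0 ∧ p.natDegree ≤ D ∧
      ∀ (n : ℕ) (x : Fin n → ℝ) (c : Fin n → ℂ),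
        0 ≤ (weilQuadratic (fun t => ∑ k, c k *
          (∑ j ∈ Finset.range (p.natDegree + 1),
            p.coeff j * (-1 : ℂ) ^ j * iteratedDeriv j f (t - x k)))).re := by
  sorry

/-- **Stub 6 — THE COFINITE WEIL CRITERION (orbit form; closable now, M).**  If every test function
`f` admits a non-zero polynomial `p` of degree `≤ D` with `Re Q ≥ 0` on the translation span of
`h := p(-D) f`, then all but finitely many (indeed `≤ 2D`) non-trivial zeros are on the line:
`ĥ(s) = p(s-½) f̂(s)` (`weilMellin_deriv` iterated, `weilMellin_add`, `weilMellin_const_mul`);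
positivity on the span contains positivity at `h` and at every `translateMix h c x`, which is all the
proof of `WeilConverse.order_mul_pairCoeff_eq_zero` uses (`zeroForm = Q` by `explicit_formula_holds` +
`hasWeilZeroSide_zeroForm`; `norm_expSum_le`; `BoundedPowerSum.sum_fiber_eq_zero_of_exp_real`), so
`m(ρ) ĥ(ρ) conj ĥ(1-ρ̄) = 0` at every zero with `Re ρ ≠ ½`: the off-line zeros with
`f̂(ρ) f̂(1-ρ̄) ≠ 0` lie in `(½ + roots p) ∪ (½ - conj roots p)`.  A narrow bump `f_ε = ε⁻¹ b(·/ε)`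
has `f̂_ε → ∫ b ≠ 0` locally uniformly, so any `2D + 1` off-line zeros are seen by one `f`:
contradiction.  This is the `←` half of the card's `CofiniteCriticalLine ↔ WeilPositivityModFinset`
in the form the line consumes (the `→` half, calibration, is `explicit_formula_holds` with `S` = the
off-line zeros). -/
theorem stub_cofiniteWeilCriterion :
    (∃ D : ℕ, ∀ f : ℝ → ℂ, IsWeilTest f → ∃ p : Polynomial ℂ, p ≠ 0 ∧ p.natDegree ≤ D ∧
        ∀ (n : ℕ) (x : Fin n → ℝ) (c : Fin n → ℂ),
          0 ≤ (weilQuadratic (fun t => ∑ k, c k *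
            (∑ j ∈ Finset.range (p.natDegree + 1),
              p.coeff j * (-1 : ℂ) ^ j * iteratedDeriv j f (t - x k)))).re) →
    {s : ℂ | riemannZeta s = 0 ∧ 0 < s.re ∧ s.re < 1 ∧ s.re ≠ 1 / 2}.Finite := by
  sorry

/-! ### Restriction: the index bound is antitone in the window -/

/-- Restriction: an index bound on a window passes to every smaller window (used by the
composition for the windows `a ≤ a₁`). [folklore] -/
theorem windowIndexLE_anti {a b : ℝ} {N : ℕ} (hab : a ≤ b)
    (h : ∀ g : Fin (N + 1) → ℝ → ℂ, (∀ i, IsWeilTest (g i)) →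
        (∀ i, tsupport (g i) ⊆ Set.Icc (-b) b) →
        ∃ c : Fin (N + 1) → ℂ, c ≠ 0 ∧ 0 ≤ (weilQuadratic (fun t => ∑ i, c i * g i t)).re) :
    ∀ g : Fin (N + 1) → ℝ → ℂ, (∀ i, IsWeilTest (g i)) →
      (∀ i, tsupport (g i) ⊆ Set.Icc (-a) a) →
      ∃ c : Fin (N + 1) → ℂ, c ≠ 0 ∧ 0 ≤ (weilQuadratic (fun t => ∑ i, c i * g i t)).re :=
  fun g hg hsupp => h g hg fun i => (hsupp i).trans (Set.Icc_subset_Icc (neg_le_neg hab) hab)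

/-! ### The composition (kernel-checked; concludes the crux BY NAME; uses the stubs by name) -/

/-- **`CofiniteCriticalLine` from the six stubs.**  `a₁ := max a₀ 1 > 0` (`a₀` from Stub 1);
Stub 4 bounds the index on the window `a₁` by some `N`; smaller windows inherit the bound by
restriction (`windowIndexLE_anti`); a larger window violating it would, by Stub 3 fed with Stub 2,
produce a conjugate window in `[a₁, a] ⊆ [a₀, ∞)`, which Stub 1 forbids; so the window index is
uniformly `≤ N`, Stub 5 definitizes, and Stub 6 (the cofinite Weil criterion) gives the finiteness of
the off-line zero set, which is the crux `RuelleBand.CofiniteCriticalLine` verbatim. -/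
theorem CofiniteCriticalLine_of :
    Summit.RiemannHypothesis.RiemannHypothesis.Theses.RuelleBand.CofiniteCriticalLine := by
  show {s : ℂ | riemannZeta s = 0 ∧ 0 < s.re ∧ s.re < 1 ∧ s.re ≠ 1 / 2}.Finite
  refine stub_cofiniteWeilCriterion (stub_definitize ?_)
  obtain ⟨a₀, ha₀⟩ := stub_eventuallyNondegenerate
  obtain ⟨N, hN⟩ := stub_windowIndexFinite (max a₀ 1)
  refine ⟨N, fun a => ?_⟩
  by_cases ha : a ≤ max a₀ 1
  · exact windowIndexLE_anti ha hN
  · intro g hg hsupp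
    by_contra hneg
    have hfail : ¬ (∀ g : Fin (N + 1) → ℝ → ℂ, (∀ i, IsWeilTest (g i)) →
          (∀ i, tsupport (g i) ⊆ Set.Icc (-a) a) →
          ∃ c : Fin (N + 1) → ℂ, c ≠ 0 ∧ 0 ≤ (weilQuadratic (fun t => ∑ i, c i * g i t)).re) :=
      fun hall => hneg (hall g hg hsupp)
    obtain ⟨b, hb, hnull⟩ :=
      conjugateWindow_of_stubs stub_branchesContinuous N (max a₀ 1) a
        (lt_of_lt_of_le one_pos (le_max_right _ _)) (not_le.mp ha).le hN hfail
    exact ha₀ b ((le_max_left _ _).trans hb.1) hnull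

end Summit.RiemannHypothesis.RiemannHypothesis.Cruxes.CofiniteCriticalLine.CofiniteWeilIndexStaircase

end
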